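import Summits.FinalStateConjecture.FinalStateConjecture.Theses.ExactKerrEnds
import Literature.Geometry.Lorentzian.TameBreathingCurve
import Literature.Geometry.Lorentzian.ExactKerrEnd
import Literature.Geometry.Lorentzian.ExactKerrEndTrivialData
import Literature.Geometry.Lorentzian.TrivialDataAdmissible

/-!
# `CensorshipAlongKerrEnds` (crux stmt-FinalStateConjecture-18521, route `ExactKerrEnds`, rank 3):
# what is load-bearing, and the shape of every counterexample

Negative-side support file of the crux disprover (cdisprove seat, 2026-08-17). Everything proved, no
definitions, no named facts, no instances. Write `C₁` for the crux: for every `X`, end `e` and tame curve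
`F` of admissible data on `e`, immersed-injective or constant [H2], with admissible members [H3] that are
Kerr-ended off `0` [H4], there is a tame injective immersed admissible curve `F'`, `F' 0 = F 0`, whose
members off `0` are Kerr-ended AND censored (every MAXIMAL vacuum Cauchy development has complete `𝓘⁺`).
Kerr-endedness is written with the Literature notion `InitialDataSet.HasExactKerrEnd`, which is the crux's
let-bound legend verbatim (`InitialDataSet.hasExactKerrEnd_iff`, `Iff.rfl`). Recorded here, kernel-checked:

* `kerrEndedCurve_without_censored` — `C₁` with the conjunct "censored" DELETED from its conclusion is a
  theorem: the whole content of `C₁` is the censoredness of the output members (so no hypothesis of `C₁`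
  admits an in-tree `_false_without_` lemma: every falsity certificate is a non-censored datum);
* `not_pointwise_of_not_censorshipAlongKerrEnds`, `exists_isMaximal_not_complete_of_not_censorshipAlongKerrEnds`
  — every refutation of `C₁` refutes POINTWISE censorship of admissible Kerr-ended data, i.e. produces an
  admissible Kerr-ended datum with a CERTIFIED maximal vacuum Cauchy development of incomplete `𝓘⁺`
  (no `IsMaximal` certificate exists in the tree — Choquet-Bruhat–Geroch is undischarged — and no `C^∞`
  vacuum datum with incomplete `𝓘⁺` exists in print: Shlapentokh-Rothman 2025, §4.5 (2));
* `not_immInjCase_iff_not_censorshipAlongKerrEnds` — the constant disjunct of [H2] is not load-bearing;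
* `not_withoutKerrEndedHyp_iff` — deleting [H4] adjoins exactly the failure modes of the route's gluing
  crux `TameEscapeToKerrEnds` (the [H4]-less statement is `C₁ ∧ TameEscapeToKerrEnds`);
* `censorshipAlongKerrEnds_false_without_isMaximal_of` — `IsMaximal` inside "censored" is load-bearing,
  modulo the same unconstructed true fact as the sibling `WeakCosmicCensorshipTame.Negative.LoadBearing`
  (every admissible datum on `ℝ³` has SOME vacuum Cauchy development with incomplete `𝓘⁺`).

The positive by-products (`PointwiseKerrEndedCensorship → C₁`, `C₁ ↔ immersed case`) live in the crux
work file `Cruxes/CensorshipAlongKerrEnds/Disproof.lean` and travel as item evidence only.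
-/

-- the problem namespace `FinalStateConjecture.FinalStateConjecture` (single-conjunct summit) trips dupNamespace
set_option linter.dupNamespace false

noncomputable section

open scoped Manifold ContDiff Topology
open Set Function Filter TopologicalSpace

namespace Summit.FinalStateConjecture.FinalStateConjecture.Theorems.CensorshipAlongKerrEnds.Negative

open Literature.Geometry.Lorentzian
open Summit.FinalStateConjecture.FinalStateConjecture.Theses.ExactKerrEnds
  (CensorshipAlongKerrEnds TameEscapeToKerrEnds)

section Helpers

variable {X : Type} [TopologicalSpace X] [ChartedSpace E3 X] [IsManifold (𝓡 3) ∞ X] [T2Space X]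
  [SecondCountableTopology X] [ConnectedSpace X]

omit [T2Space X] [SecondCountableTopology X] [ConnectedSpace X] in
/-- A constant curve whose members off `0` have a property has it at the base (`ℝ¹` has a non-zero
vector). [folklore] -/
private theorem base_of_const {F : EuclideanSpace ℝ (Fin 1) → InitialDataSet (𝓡 3) X}
    {Q : InitialDataSet (𝓡 3) X → Prop} (hconst : ∀ c, F c = F 0) (hQ : ∀ c ≠ 0, Q (F c)) :
    Q (F 0) := by
  have hc : (EuclideanSpace.single (0 : Fin 1) (1 : ℝ) : EuclideanSpace ℝ (Fin 1)) ≠ 0 := by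
    rw [← norm_ne_zero_iff, PiLp.norm_single, norm_one]
    exact one_ne_zero
  rw [← hconst (EuclideanSpace.single (0 : Fin 1) (1 : ℝ))]
  exact hQ _ hc

/-- Kerr-ended self-witness: through every admissible Kerr-ended datum passes a tame, injective,
immersed curve of admissible KERR-ENDED data (the breathing curve of `d`,
`InitialDataSet.exists_tame_selfWitness`, whose members agree with `d` off one compact set;
`HasExactKerrEnd.of_eq_off_compact`). [folklore] -/
private theorem kerrEndedSelfWitness {d : InitialDataSet (𝓡 3) X} (hd : d ∈ admissibleVacuumData X)
    (hKE : d.HasExactKerrEnd) :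
    ∃ (e' : AFEnd X) (F' : EuclideanSpace ℝ (Fin 1) → InitialDataSet (𝓡 3) X),
      InitialDataSet.IsTameDataFamily e' 1 F' ∧ F' 0 = d ∧ Injective F' ∧
        InitialDataSet.IsImmersedAtZero 1 F' ∧ (∀ c, F' c ∈ admissibleVacuumData X) ∧
          ∀ c, (F' c).HasExactKerrEnd := by
  obtain ⟨e', F', hF', himm', h0', hinj', h𝓓', K, hK, hagree⟩ :=
    InitialDataSet.exists_tame_selfWitness hd
  exact ⟨e', F', hF', h0', hinj', himm', h𝓓', fun c ↦
    hKE.of_eq_off_compact hK (fun x hx ↦ (hagree c x hx).1) fun x hx ↦ (hagree c x hx).2⟩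

omit [T2Space X] [SecondCountableTopology X] [ConnectedSpace X] in
/-- A constant curve at an admissible datum is tame on the datum's sole end. [folklore] -/
private theorem const_tame {d : InitialDataSet (𝓡 3) X} (hd : d ∈ admissibleVacuumData X) :
    ∃ e : AFEnd X, InitialDataSet.IsTameDataFamily e 1 (fun _ : EuclideanSpace ℝ (Fin 1) ↦ d) := by
  obtain ⟨-, e, M, hsole, hdecay⟩ := id hd
  exact ⟨e, InitialDataSet.isTameDataFamily_const hsole 1 hdecay⟩

end Helpers

/-! ## §1 The `Censored` conjunct carries all the content -/

/-- **`C₁` minus "censored" is a theorem.** For every `X`, end `e` and tame curve `F` of admissible data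
on `e`, immersed-injective or constant, with Kerr-ended members off `0`, there IS a tame, injective,
immersed curve of admissible data through `F 0` with Kerr-ended members off `0` (immersed-injective
input: `F` itself; constant input: the base is Kerr-ended and its breathing self-witness serves). Hence
tameness, injectivity, immersion, admissibility and Kerr-endedness of the output are FREE in `C₁`; a
refutation can only ever refute censoredness of a member. [folklore] -/
theorem kerrEndedCurve_without_censored :
    ∀ (X : Type) [TopologicalSpace X] [ChartedSpace E3 X] [IsManifold (𝓡 3) ∞ X] [T2Space X]
      [SecondCountableTopology X] [ConnectedSpace X],
      ∀ (e : AFEnd X) (F : EuclideanSpace ℝ (Fin 1) → InitialDataSet (𝓡 3) X),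
        InitialDataSet.IsTameDataFamily e 1 F →
          ((InitialDataSet.IsImmersedAtZero 1 F ∧ Injective F) ∨ ∀ c, F c = F 0) →
            (∀ c, F c ∈ admissibleVacuumData X) → (∀ c ≠ 0, (F c).HasExactKerrEnd) →
              ∃ (e' : AFEnd X) (F' : EuclideanSpace ℝ (Fin 1) → InitialDataSet (𝓡 3) X),
                InitialDataSet.IsTameDataFamily e' 1 F' ∧ F' 0 = F 0 ∧ Injective F' ∧
                  InitialDataSet.IsImmersedAtZero 1 F' ∧ (∀ c, F' c ∈ admissibleVacuumData X) ∧
                    ∀ c ≠ 0, (F' c).HasExactKerrEnd := by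
  intro X _ _ _ _ _ _ e F hF hdich h𝓓 hKE
  rcases hdich with ⟨himm, hinj⟩ | hconst
  · exact ⟨e, F, hF, rfl, hinj, himm, h𝓓, hKE⟩
  · obtain ⟨e', F', hF', h0', hinj', himm', h𝓓', hKE'⟩ :=
      kerrEndedSelfWitness (h𝓓 0) (base_of_const hconst hKE)
    exact ⟨e', F', hF', h0', hinj', himm', h𝓓', fun c _ ↦ hKE' c⟩

/-! ## §2 Every counterexample is a non-censored admissible Kerr-ended datum with a certified MGHD -/

/-- **A refutation of `C₁` refutes POINTWISE censorship of admissible Kerr-ended data** ("every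
admissible Kerr-ended datum has all its maximal vacuum Cauchy developments with complete `𝓘⁺`"):
pointwise censorship applied to the members of the free Kerr-ended curve
(`kerrEndedCurve_without_censored`) would prove `C₁`. [folklore] -/
theorem not_pointwise_of_not_censorshipAlongKerrEnds (h : ¬ CensorshipAlongKerrEnds) :
    ¬ ∀ (X : Type) [TopologicalSpace X] [ChartedSpace E3 X] [IsManifold (𝓡 3) ∞ X] [T2Space X]
      [SecondCountableTopology X] [ConnectedSpace X],
      ∀ d ∈ admissibleVacuumData X, d.HasExactKerrEnd →
        ∀ 𝒟 : VacuumCauchyDevelopment d, 𝒟.IsMaximal →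
          _root_.Summit.FinalStateConjecture.HasCompleteNullInfinity 𝒟.toCauchyDevelopment := by
  intro hp
  refine h fun X _ _ _ _ _ _ e F hF hdich h𝓓 hKE ↦ ?_
  obtain ⟨e', F', hF', h0', hinj', himm', h𝓓', hKE'⟩ :=
    kerrEndedCurve_without_censored X e F hF hdich h𝓓 hKE
  exact ⟨e', F', hF', h0', hinj', himm', h𝓓', fun c hc ↦
    ⟨hKE' c hc, hp X (F' c) (h𝓓' c) (hKE' c hc)⟩⟩

/-- **Refutation certificate.** Any proof of `¬ C₁` produces a `3`-manifold `X`, an admissible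
Kerr-ended datum `d` on it and a vacuum Cauchy development `𝒟` of `d` which is MAXIMAL (every vacuum
Cauchy development of `d` embeds into `𝒟`) and whose future null infinity is INCOMPLETE. In the current
tree no development of any datum carries an `IsMaximal` certificate (the Choquet-Bruhat–Geroch theorem
is an undischarged fact), so `¬ C₁` is at present unprovable whatever the physics; in print no `C^∞`,
complete, asymptotically flat vacuum datum with incomplete `𝓘⁺` is known (the Rodnianski–
Shlapentokh-Rothman naked singularities have `C^{1,s}` data).
[cite: ChoquetBruhatGeroch1969CMP, Theorem p. 331] [cite: RodnianskiShlapentokhRothman2023, Thm. 1] -/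
theorem exists_isMaximal_not_complete_of_not_censorshipAlongKerrEnds (h : ¬ CensorshipAlongKerrEnds) :
    ∃ (X : Type) (_ : TopologicalSpace X) (_ : ChartedSpace E3 X) (_ : IsManifold (𝓡 3) ∞ X)
      (_ : T2Space X) (_ : SecondCountableTopology X) (_ : ConnectedSpace X)
      (d : InitialDataSet (𝓡 3) X), d ∈ admissibleVacuumData X ∧ d.HasExactKerrEnd ∧
        ∃ 𝒟 : VacuumCauchyDevelopment d, 𝒟.IsMaximal ∧
          ¬ _root_.Summit.FinalStateConjecture.HasCompleteNullInfinity 𝒟.toCauchyDevelopment := by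
  by_contra hno
  refine not_pointwise_of_not_censorshipAlongKerrEnds h fun X _ _ _ _ _ _ d hd hKE 𝒟 h𝒟 ↦ ?_
  by_contra hinc
  exact hno ⟨X, inferInstance, inferInstance, inferInstance, inferInstance, inferInstance,
    inferInstance, d, hd, hKE, 𝒟, h𝒟, hinc⟩

/-! ## §3 Which hypotheses are load-bearing -/

/-- **The constant disjunct of [H2] is not load-bearing**: `C₁` fails iff its IMMERSED-INJECTIVE case
fails (a constant admissible curve with Kerr-ended members has a Kerr-ended base, which is the base of
its own Kerr-ended breathing curve, to which the immersed case applies). [folklore] -/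
theorem not_immInjCase_iff_not_censorshipAlongKerrEnds :
    (¬ ∀ (X : Type) [TopologicalSpace X] [ChartedSpace E3 X] [IsManifold (𝓡 3) ∞ X] [T2Space X]
        [SecondCountableTopology X] [ConnectedSpace X],
        ∀ (e : AFEnd X) (F : EuclideanSpace ℝ (Fin 1) → InitialDataSet (𝓡 3) X),
          InitialDataSet.IsTameDataFamily e 1 F → InitialDataSet.IsImmersedAtZero 1 F →
            Injective F → (∀ c, F c ∈ admissibleVacuumData X) →
              (∀ c ≠ 0, (F c).HasExactKerrEnd) →
                ∃ (e' : AFEnd X) (F' : EuclideanSpace ℝ (Fin 1) → InitialDataSet (𝓡 3) X),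
                  InitialDataSet.IsTameDataFamily e' 1 F' ∧ F' 0 = F 0 ∧ Injective F' ∧
                    InitialDataSet.IsImmersedAtZero 1 F' ∧ (∀ c, F' c ∈ admissibleVacuumData X) ∧
                      ∀ c ≠ 0, (F' c).HasExactKerrEnd ∧
                        ∀ 𝒟 : VacuumCauchyDevelopment (F' c), 𝒟.IsMaximal →
                          _root_.Summit.FinalStateConjecture.HasCompleteNullInfinity
                            𝒟.toCauchyDevelopment) ↔
      ¬ CensorshipAlongKerrEnds := by
  refine not_congr ⟨fun h X _ _ _ _ _ _ e F hF hdich h𝓓 hKE ↦ ?_,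
    fun h X _ _ _ _ _ _ e F hF himm hinj h𝓓 hKE ↦ h X e F hF (Or.inl ⟨himm, hinj⟩) h𝓓 hKE⟩
  rcases hdich with ⟨himm, hinj⟩ | hconst
  · exact h X e F hF himm hinj h𝓓 hKE
  · have hKE0 : (F 0).HasExactKerrEnd :=
      base_of_const (Q := fun D ↦ D.HasExactKerrEnd) hconst hKE
    obtain ⟨e', F', hF', h0', hinj', himm', h𝓓', hKE'⟩ := kerrEndedSelfWitness (h𝓓 0) hKE0
    obtain ⟨e'', F'', hF'', h0'', hrest⟩ := h X e' F' hF' himm' hinj' h𝓓' fun c _ ↦ hKE' c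
    exact ⟨e'', F'', hF'', h0''.trans h0', hrest⟩

/-- **[H4] is exactly the interface to the gluing crux: the failure modes of the [H4]-less statement are
those of `C₁` together with those of `TameEscapeToKerrEnds`.** Without [H4] the statement asks a good
curve through EVERY admissible datum (constant curves are tame); that is `C₁` (ignore [H4]) AND
`TameEscapeToKerrEnds` (good members are Kerr-ended, hence not exceptional); conversely at a Kerr-ended
base feed `C₁` the constant curve and at a non-Kerr-ended base feed it the Kerr-ended tame escape
supplied by `TameEscapeToKerrEnds`. So a refutation of the [H4]-less statement may be a pure
Corvino–Schoen GLUING obstruction with every datum censored, whereas a refutation of `C₁` never is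
(`exists_isMaximal_not_complete_of_not_censorshipAlongKerrEnds`). [folklore] -/
theorem not_withoutKerrEndedHyp_iff :
    (¬ ∀ (X : Type) [TopologicalSpace X] [ChartedSpace E3 X] [IsManifold (𝓡 3) ∞ X] [T2Space X]
        [SecondCountableTopology X] [ConnectedSpace X],
        ∀ (e : AFEnd X) (F : EuclideanSpace ℝ (Fin 1) → InitialDataSet (𝓡 3) X),
          InitialDataSet.IsTameDataFamily e 1 F →
            ((InitialDataSet.IsImmersedAtZero 1 F ∧ Injective F) ∨ ∀ c, F c = F 0) →
              (∀ c, F c ∈ admissibleVacuumData X) →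
                ∃ (e' : AFEnd X) (F' : EuclideanSpace ℝ (Fin 1) → InitialDataSet (𝓡 3) X),
                  InitialDataSet.IsTameDataFamily e' 1 F' ∧ F' 0 = F 0 ∧ Injective F' ∧
                    InitialDataSet.IsImmersedAtZero 1 F' ∧ (∀ c, F' c ∈ admissibleVacuumData X) ∧
                      ∀ c ≠ 0, (F' c).HasExactKerrEnd ∧
                        ∀ 𝒟 : VacuumCauchyDevelopment (F' c), 𝒟.IsMaximal →
                          _root_.Summit.FinalStateConjecture.HasCompleteNullInfinity
                            𝒟.toCauchyDevelopment) ↔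
      ¬ CensorshipAlongKerrEnds ∨ ¬ TameEscapeToKerrEnds := by
  rw [← not_and_or]
  refine not_congr ⟨fun h ↦ ⟨fun X _ _ _ _ _ _ e F hF hdich h𝓓 _ ↦ h X e F hF hdich h𝓓,
    fun X _ _ _ _ _ _ d hd ↦ ?_⟩, fun ⟨hC, hE⟩ X _ _ _ _ _ _ e F _ _ h𝓓 ↦ ?_⟩
  · -- `TameEscapeToKerrEnds` from good curves through the constant curve at `d`
    obtain ⟨e, he⟩ := const_tame hd.1
    obtain ⟨e', F', hF', h0', hinj', himm', h𝓓', hgood⟩ :=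
      h X e (fun _ ↦ d) he (Or.inr fun _ ↦ rfl) fun _ ↦ hd.1
    exact ⟨e', F', hF', himm', h0', hinj', h𝓓', fun c hc hmem ↦ hmem.2 (hgood c hc).1⟩
  · have hd : F 0 ∈ admissibleVacuumData X := h𝓓 0
    by_cases hKE : (F 0).HasExactKerrEnd
    · obtain ⟨e₀, he₀⟩ := const_tame hd
      exact hC X e₀ (fun _ ↦ F 0) he₀ (Or.inr fun _ ↦ rfl) (fun _ ↦ hd) fun _ _ ↦ hKE
    · obtain ⟨e₀, F₀, hF₀, himm₀, h0, hinj₀, h𝓓₀, hesc⟩ := hE X (F 0) ⟨hd, hKE⟩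
      have hKE₀ : ∀ c ≠ 0, (F₀ c).HasExactKerrEnd := fun c hc ↦ by
        by_contra hn
        exact hesc c hc ⟨h𝓓₀ c, hn⟩
      obtain ⟨e', F', hF', h0', hrest⟩ := hC X e₀ F₀ hF₀ (Or.inl ⟨himm₀, hinj₀⟩) h𝓓₀ hKE₀
      exact ⟨e', F', hF', h0'.trans h0, hrest⟩

/-- **`IsMaximal` is load-bearing** (modulo the true, here unconstructed fact `H` that every admissible
datum on `ℝ³` has SOME vacuum Cauchy development with incomplete future null infinity — local existence
followed by truncation in a Cauchy time function; for the trivial datum this is the time-truncated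
Minkowski space of `WeakCosmicCensorshipMGHD.Negative.TruncatedMinkowski`): `C₁` with `IsMaximal`
DELETED from "censored" is false — feed it the constant curve at the trivial datum `(ℝ³, δ, 0)`
(admissible, `trivialData_mem_admissibleVacuumData`; Kerr-ended with `M = 0`,
`hasExactKerrEnd_trivialData`); every member of the answered curve is admissible on `ℝ³`, so by `H` it
has a development with incomplete `𝓘⁺`. Same `H` as `WeakCosmicCensorshipTame.Negative.LoadBearing`.
[cite: ChoquetBruhatGeroch1969CMP, p. 330] -/
theorem censorshipAlongKerrEnds_false_without_isMaximal_of
    (H : ∀ D ∈ admissibleVacuumData Minkowski.slice, ∃ 𝒟 : VacuumCauchyDevelopment D,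
      ¬ _root_.Summit.FinalStateConjecture.HasCompleteNullInfinity 𝒟.toCauchyDevelopment) :
    ¬ ∀ (X : Type) [TopologicalSpace X] [ChartedSpace E3 X] [IsManifold (𝓡 3) ∞ X] [T2Space X]
      [SecondCountableTopology X] [ConnectedSpace X],
      ∀ (e : AFEnd X) (F : EuclideanSpace ℝ (Fin 1) → InitialDataSet (𝓡 3) X),
        InitialDataSet.IsTameDataFamily e 1 F →
          ((InitialDataSet.IsImmersedAtZero 1 F ∧ Injective F) ∨ ∀ c, F c = F 0) →
            (∀ c, F c ∈ admissibleVacuumData X) → (∀ c ≠ 0, (F c).HasExactKerrEnd) →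
              ∃ (e' : AFEnd X) (F' : EuclideanSpace ℝ (Fin 1) → InitialDataSet (𝓡 3) X),
                InitialDataSet.IsTameDataFamily e' 1 F' ∧ F' 0 = F 0 ∧ Injective F' ∧
                  InitialDataSet.IsImmersedAtZero 1 F' ∧ (∀ c, F' c ∈ admissibleVacuumData X) ∧
                    ∀ c ≠ 0, (F' c).HasExactKerrEnd ∧
                      ∀ 𝒟 : VacuumCauchyDevelopment (F' c),
                        _root_.Summit.FinalStateConjecture.HasCompleteNullInfinity
                          𝒟.toCauchyDevelopment := by
  intro h
  obtain ⟨e, he⟩ := const_tame trivialData_mem_admissibleVacuumData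
  obtain ⟨e', F', -, -, -, -, h𝓓', hgood⟩ :=
    h Minkowski.slice e (fun _ ↦ trivialData) he (Or.inr fun _ ↦ rfl)
      (fun _ ↦ trivialData_mem_admissibleVacuumData) fun _ _ ↦ hasExactKerrEnd_trivialData
  have hc : (EuclideanSpace.single (0 : Fin 1) (1 : ℝ) : EuclideanSpace ℝ (Fin 1)) ≠ 0 := by
    rw [← norm_ne_zero_iff, PiLp.norm_single, norm_one]
    exact one_ne_zero
  obtain ⟨𝒟, h𝒟⟩ := H (F' _) (h𝓓' (EuclideanSpace.single (0 : Fin 1) (1 : ℝ)))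
  exact h𝒟 ((hgood _ hc).2 𝒟)

end Summit.FinalStateConjecture.FinalStateConjecture.Theorems.CensorshipAlongKerrEnds.Negative

end
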